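/-
Copyright (c) 2026 the pub-hodgecm-mathlib formalisation cell (harness21).  Prover seat hodgecm-mathlib-LH4-p08 (g10), req620 Track A «(D-RAM) FOUR-FRAME» squad, helper lane
on h413 = stmt-HodgeConjecture-24833 (count-neutral).  β sub-dealer LH4-p05 (g8) LEDGER #12∕#13: ROW R6 «SPECIAL κ-CLASSES», step (β3-foot): the orbit sums of the tower-3 κ-row
over the INVERTED-RESCALED system (R6-DERIVATION v2 0628fb8c §4).  Pattern: ★ p861608 `…LabelledOddBoundarySums` (LH4-p17 (g0)).  2026-09-04.
-/
import Summits.HodgeConjecture.HodgeConjecture.Theorems.F0P3cDyRamDiagonalKappaGluedClassSums   -- ★ κG-B2 (LH4-p09 (g3)): `sum_normSign_one_add_boundary`, `…_eq_zero`, `normSign_eq_of_near_level`; brings ★ κG-B1 `sum_eq_zero_of_twist`, ★ conductor toolkit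
import HarnessLib

/-!
# Crux `H413`, line LH4 «(D-RAM) FOUR-FRAME» — (β) Stage B, β-BOARD row R6 (tower 3), step (β3-foot): THE ORBIT CHARACTER SUMS OF THE κ-CLASSES OVER THE INVERTED SYSTEM
# `Σ_{g ∈ R} ω(1 + κ·g⁻¹)`, `Σ_{g ∈ R} ω(g)·ω(1 + κ·g⁻¹)`, `Σ_{g ∈ R} ω(g)·ω(1+g)·ω(1 + κ·g⁻¹)`

Cell `hodgecm-mathlib` (D-0151), FLOOR 0, crux item H413 = `stmt-HodgeConjecture-24833`, route `HCCMUnconditional`; squad F0∕P3c∕LH4.  THEOREMS ONLY (no `def`, no instance, no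
notation, no `sorry`, default heartbeats); ★-only imports; lane `--supports stmt-HodgeConjecture-24833 --as helper` (count-neutral); pays NO row, states NO law.

THE MATHEMATICS (R6-DERIVATION v2 §2–§4 of this seat; [Serre1979, V §3 ∕ XV §2], [LanglandsShelstad1987, §3]).  `R` is a complete irredundant system of the `σ`-fixed
elements of valuation `|ϖ|^{2t}` modulo `𝔭^{ρ+2t}` — the orbit parameters of the glued stratum `G₃(ρ, 2t) = (2ρ+2t, 2ρ+2t, 2ρ)` (★ p861619
`finsum_stratum_G3_shell_labelledOdd_div_relIndex_eq_card_mul_sum`, LH4-p18 (g0)).  On the κ-LOCUS `2ρ + ℓ₀ = n₁ = n₂` (the foot of the special tower 3, LH4-p11 (g9) ★ p861570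
`twoSlotLabel_latt_G3_foot`) the per-orbit signs of the labelled odd value are `ω(W(g))·(ω(1+g), ω(−1), ω(−g))` with
`W(g) = g·e_B·π₀^ρ·(1 − κ′(1+g)∕g) = g·e_B·π₀^ρ·(1−κ′)·(1 + κ″·g⁻¹)`, `κ″ = −κ′∕(1−κ′)`, `|κ″·g⁻¹| = |ϖ|^{s_g − 2t}` — the TWIST now sits on `g⁻¹` (on the tube it sat on
`g∕(1+g)`, ★ p861608 §3).  So the stratum table needs the three sums of the title, and this file provides them by carrying `R` through the INVERSION-RESCALING `g ↦ κ∕g`: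
* §1 `image_div_repr` — if `|κ| = |ϖ|^{2t}·|ϖ|^{2t′}` (`κ` fixed) then `{κ∕g : g ∈ R}` is a complete irredundant system of the fixed elements of valuation `|ϖ|^{2t′}` modulo `𝔭^{ρ+2t′}`
  (`|κ∕g − κ∕g′| = |κ|·|g − g′|∕|g g′|`), and `g ↦ κ∕g` is injective on `R`;
* §2 `Σ_{g ∈ R} ω(1 + κ∕g)`: `= #R` when `2d − 1 ≤ 2t′` (DEEP), `= −q^{⌈ρ∕2⌉−1}` at the BOUNDARY `t′ + 1 = d` (`ρ ≥ 1`), `= 0` BELOW (`1 ≤ t′`, `t′ + 2 ≤ d`) inside the window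
  `2d ≤ ρ + 2t′ + 1` — ★ κG-B2 on the image system (§1 + `Finset.sum_image`);
* §3 `Σ_{g ∈ R} ω(g)·ω(1 + κ∕g) = 0` and §4 `Σ_{g ∈ R} ω(g)·ω(1+g)·ω(1 + κ∕g) = 0` for `2d ≤ ρ + 1`, `1 ≤ t`, `1 ≤ t′`: the non-norm twist `g ↦ n·g` (`n ≡ 1 (ϖ^{2d−2})`, ★
  `exists_fixed_unit_not_norm_v_sub_one_le`) flips `ω(g)` and fixes `ω(1+g)` and `ω(1 + κ∕g)` (`|κ∕g|·|n⁻¹ − 1| ≤ |ϖ|^{2t′+2d−2} ≤ |ϖ|^{2d−1}`); ★ κG-B1 `sum_eq_zero_of_twist`.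
With `2t′ = s_g − 2t = D` (the twist depth of the κ-class `(ρ, 2t)`), §2 is the `F(D)`-pattern of the κ-row in slot 2 and §3∕§4 kill slots 1∕0 (R6-DERIVATION v2 §4); the assembly
`…LabelledOddKappaClassG3` (this seat) does the bookkeeping.
HONEST LABEL.  Count-neutral; proves no census; R6 head∕hRest∕(β-BAL)∕(β)∕T₊ OPEN; `HC_CM` is proved only modulo the 7 printed citations (2 remaining named inputs: hLiu418 =
`stmt-HodgeConjecture-24832`, h413 = `stmt-HodgeConjecture-24833`) until rung 0 closes.

## References
* [Serre1979] J.-P. Serre, *Local Fields*, GTM 67 (1979) — Ch. IV §2 Prop. 6 (systems of representatives), Ch. V §3 Prop. 5, Cor. 3, Ch. XV §2 (norm groups, conductor of a ramified quadratic extension).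
* [LanglandsShelstad1987] R. P. Langlands, D. Shelstad, *On the definition of transfer factors*, Math. Ann. 278 (1987), §3 (κ-signs as characters).
* [Kottwitz1986BaseChangeUnits] R. E. Kottwitz, *Base change for unit elements of Hecke algebras*, Compositio Math. 60 (1986), §1 pp. 240–241 (orbit sums).
-/

set_option autoImplicit false

noncomputable section

namespace Summit.HodgeConjecture.HodgeConjecture.Cruxes.H413.F0P3cDyRamKappaClassFootSums

open WithZero
open Literature.NumberTheory.Automorphic Literature.NumberTheory.Automorphic.UnitaryThreeFourFrame
open Literature.NumberTheory.LocalFields.WildQuadraticDatum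
open Summit.HodgeConjecture.HodgeConjecture.Cruxes.H413.F0P3cDyRamDiagonalFixedClassSystems
open Summit.HodgeConjecture.HodgeConjecture.Cruxes.H413.F0P3cDyRamDiagonalKappaGluedClassSums
open scoped Valued

variable {K : Type} [Field K] [Valued K ℤᵐ⁰]

/-! ## §1  The inversion-rescaling carries a system of representatives to a system of representatives -/

/-- **INVERTED-RESCALED SYSTEM**: if `R` is a complete irredundant system of the fixed elements of valuation `|ϖ|^{2t}` modulo `𝔭^{ρ+2t}` and `κ` is fixed with
`|κ| = |ϖ|^{2t}·|ϖ|^{2t′}`, then `{κ∕g : g ∈ R}` is a complete irredundant system of the fixed elements of valuation `|ϖ|^{2t′}` modulo `𝔭^{ρ+2t′}`, and `g ↦ κ∕g` is injective on `R`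
(`κ∕g − κ∕g′ = κ(g′ − g)∕(g g′)`). [cite: Serre1979, Ch. IV §2 Prop. 6] -/
theorem image_div_repr {σ : K →+* K} {ϖ : K} (hϖ0 : ϖ ≠ 0) {ρ t t' : ℕ} (R : Finset K) (hR1 : ∀ g ∈ R, σ g = g ∧ Valued.v g = Valued.v ϖ ^ (2 * t))
    (hR2 : ∀ f : K, σ f = f → Valued.v f = Valued.v ϖ ^ (2 * t) → ∃ g ∈ R, Valued.v (f - g) ≤ Valued.v ϖ ^ (ρ + 2 * t))
    (hR3 : ∀ g ∈ R, ∀ g' ∈ R, Valued.v (g - g') ≤ Valued.v ϖ ^ (ρ + 2 * t) → g = g')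
    {κ : K} (hσκ : σ κ = κ) (hκ : Valued.v κ = Valued.v ϖ ^ (2 * t) * Valued.v ϖ ^ (2 * t')) [DecidableEq K] :
    (∀ h ∈ R.image (fun g => κ / g), σ h = h ∧ Valued.v h = Valued.v ϖ ^ (2 * t')) ∧
      (∀ f : K, σ f = f → Valued.v f = Valued.v ϖ ^ (2 * t') → ∃ h ∈ R.image (fun g => κ / g), Valued.v (f - h) ≤ Valued.v ϖ ^ (ρ + 2 * t')) ∧
      (∀ h ∈ R.image (fun g => κ / g), ∀ h' ∈ R.image (fun g => κ / g), Valued.v (h - h') ≤ Valued.v ϖ ^ (ρ + 2 * t') → h = h') ∧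
      Set.InjOn (fun g => κ / g) (R : Set K) := by
  have hvϖ : 0 < Valued.v ϖ := (Valuation.pos_iff _).2 hϖ0
  have hpt : ∀ n : ℕ, Valued.v ϖ ^ n ≠ 0 := fun n => pow_ne_zero _ hvϖ.ne'
  have hκ0 : κ ≠ 0 := fun h => by rw [h, map_zero] at hκ; exact (mul_ne_zero (hpt _) (hpt _)) hκ.symm
  -- valuation bookkeeping: `g ≠ 0` on the level, `|κ∕g| = |ϖ|^{2t′}`, and the difference identity
  have hg0 : ∀ g : K, Valued.v g = Valued.v ϖ ^ (2 * t) → g ≠ 0 := fun g hg h0 => by rw [h0, map_zero] at hg; exact (hpt _) hg.symm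
  have hvdiv : ∀ g : K, Valued.v g = Valued.v ϖ ^ (2 * t) → Valued.v (κ / g) = Valued.v ϖ ^ (2 * t') := fun g hg => by
    rw [map_div₀, hκ, hg, mul_div_cancel_left₀ _ (hpt _)]
  have hdiff : ∀ g g' : K, Valued.v g = Valued.v ϖ ^ (2 * t) → Valued.v g' = Valued.v ϖ ^ (2 * t) →
      Valued.v ϖ ^ (2 * t) * Valued.v (κ / g - κ / g') = Valued.v ϖ ^ (2 * t') * Valued.v (g - g') := by
    intro g g' hg hg'
    have e : (κ / g - κ / g') * (g * g') = κ * (g' - g) := by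
      field_simp [hg0 g hg, hg0 g' hg']
    have he := congrArg Valued.v e
    rw [map_mul, map_mul, map_mul, hg, hg', hκ, Valuation.map_sub_swap Valued.v g' g] at he
    refine mul_right_cancel₀ (hpt (2 * t)) ?_
    calc Valued.v ϖ ^ (2 * t) * Valued.v (κ / g - κ / g') * Valued.v ϖ ^ (2 * t)
        = Valued.v (κ / g - κ / g') * (Valued.v ϖ ^ (2 * t) * Valued.v ϖ ^ (2 * t)) := by ac_rfl
      _ = Valued.v ϖ ^ (2 * t) * Valued.v ϖ ^ (2 * t') * Valued.v (g - g') := he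
      _ = Valued.v ϖ ^ (2 * t') * Valued.v (g - g') * Valued.v ϖ ^ (2 * t) := by ac_rfl
  refine ⟨fun h hh => ?_, fun f hσf hvf => ?_, fun h hh h' hh' hle => ?_, fun g hg g' hg' hgg' => ?_⟩
  · obtain ⟨g, hg, rfl⟩ := Finset.mem_image.1 hh
    exact ⟨by rw [map_div₀, hσκ, (hR1 g hg).1], hvdiv g (hR1 g hg).2⟩
  · -- `f = κ∕g₀` with `g₀ = κ∕f` on the level `2t`
    have hf0 : f ≠ 0 := fun h0 => by rw [h0, map_zero] at hvf; exact (hpt _) hvf.symm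
    have hvg₀ : Valued.v (κ / f) = Valued.v ϖ ^ (2 * t) := by
      rw [map_div₀, hκ, hvf, mul_div_cancel_right₀ _ (hpt _)]
    obtain ⟨g, hg, hfg⟩ := hR2 (κ / f) (by rw [map_div₀, hσf, hσκ]) hvg₀
    refine ⟨κ / g, Finset.mem_image.2 ⟨g, hg, rfl⟩, ?_⟩
    have e : f = κ / (κ / f) := by field_simp
    have key := hdiff (κ / f) g hvg₀ (hR1 g hg).2
    rw [← e] at key
    have h1 : Valued.v ϖ ^ (2 * t) * Valued.v (f - κ / g) ≤ Valued.v ϖ ^ (2 * t) * Valued.v ϖ ^ (ρ + 2 * t') := by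
      rw [key]
      calc Valued.v ϖ ^ (2 * t') * Valued.v (κ / f - g) ≤ Valued.v ϖ ^ (2 * t') * Valued.v ϖ ^ (ρ + 2 * t) := mul_le_mul_right hfg _
        _ = Valued.v ϖ ^ (2 * t) * Valued.v ϖ ^ (ρ + 2 * t') := by rw [← pow_add, ← pow_add]; congr 1; omega
    exact le_of_mul_le_mul_left h1 (pow_pos hvϖ _)
  · obtain ⟨g, hg, rfl⟩ := Finset.mem_image.1 hh
    obtain ⟨g', hg', rfl⟩ := Finset.mem_image.1 hh'
    have key := hdiff g g' (hR1 g hg).2 (hR1 g' hg').2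
    have h1 : Valued.v ϖ ^ (2 * t') * Valued.v (g - g') ≤ Valued.v ϖ ^ (2 * t') * Valued.v ϖ ^ (ρ + 2 * t) := by
      rw [← key]
      calc Valued.v ϖ ^ (2 * t) * Valued.v (κ / g - κ / g') ≤ Valued.v ϖ ^ (2 * t) * Valued.v ϖ ^ (ρ + 2 * t') := mul_le_mul_right hle _
        _ = Valued.v ϖ ^ (2 * t') * Valued.v ϖ ^ (ρ + 2 * t) := by rw [← pow_add, ← pow_add]; congr 1; omega
    rw [hR3 g hg g' hg' (le_of_mul_le_mul_left h1 (pow_pos hvϖ _))]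
  · have hg0' := hg0 g (hR1 g hg).2
    have hg0'' := hg0 g' (hR1 g' hg').2
    have h : κ * g' = κ * g := (div_eq_div_iff hg0' hg0'').1 hgg'
    exact (mul_left_cancel₀ hκ0 h).symm

/-! ## §2  `Σ_{g ∈ R} ω(1 + κ∕g)` — deep, boundary, below -/

section Sums

variable [CompleteSpace K] [Finite 𝓀[K]] {σ : K →+* K} {ϖ : K} {d t₂ : ℕ}

omit [Finite 𝓀[K]] in
/-- **DEEP**: if `|κ| = |ϖ|^{2t}·|ϖ|^{2t′}` with `2d − 1 ≤ 2t′` then every `ω(1 + κ∕g) = 1`, so `Σ_{g ∈ R} ω(1 + κ∕g) = #R`. [cite: Serre1979, Ch. XV §2] -/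
theorem sum_normSign_one_add_div_eq_card (hD : IsRamifiedQuadraticDatum σ ϖ d t₂) {t t' : ℕ} (hdeep : 2 * d - 1 ≤ 2 * t') (R : Finset K)
    (hR1 : ∀ g ∈ R, σ g = g ∧ Valued.v g = Valued.v ϖ ^ (2 * t)) {κ : K} (hσκ : σ κ = κ) (hκ : Valued.v κ = Valued.v ϖ ^ (2 * t) * Valued.v ϖ ^ (2 * t')) :
    ∑ g ∈ R, normSign σ (1 + κ / g) = R.card := by
  have hϖ := hD.2.2.1
  have hϖ0 : ϖ ≠ 0 := fun h0 => by rw [h0, map_zero] at hϖ; exact WithZero.coe_ne_zero hϖ.symm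
  have hϖ1 : Valued.v ϖ < 1 := by rw [hϖ, ← exp_zero, exp_lt_exp]; norm_num
  have hpt : ∀ n : ℕ, Valued.v ϖ ^ n ≠ 0 := fun n => pow_ne_zero _ ((Valuation.pos_iff _).2 hϖ0).ne'
  rw [Finset.card_eq_sum_ones, Nat.cast_sum, Nat.cast_one]
  refine Finset.sum_congr rfl fun g hg => ?_
  have hv : Valued.v (κ / g) = Valued.v ϖ ^ (2 * t') := by
    rw [map_div₀, hκ, (hR1 g hg).2, mul_div_cancel_left₀ _ (hpt _)]
  exact normSign_eq_one_of_fixed_of_v_sub_one_le hD (by rw [map_add, map_one, map_div₀, hσκ, (hR1 g hg).1]) (n := 2 * t') hdeep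
    (by rw [add_sub_cancel_left, hv])

/-- **BOUNDARY**: if `|κ| = |ϖ|^{2t}·|ϖ|^{2t′}` with `t′ + 1 = d` (`ρ ≥ 1`, `t′ ≥ 1`) then `Σ_{g ∈ R} ω(1 + κ∕g) = −q^{⌈ρ∕2⌉−1}` (★ κG-B2 `sum_normSign_one_add_boundary` on the
inverted-rescaled system `κ∕R` of §1). [cite: Serre1979, Ch. V §3 Prop. 5, Cor. 3; Ch. XV §2] [cite: LanglandsShelstad1987, §3] -/
theorem sum_normSign_one_add_div_boundary (hD : IsRamifiedQuadraticDatum σ ϖ d t₂) (h2 : Valued.v (2 : K) < 1) {ρ t t' : ℕ} (hρ : 1 ≤ ρ) (ht' : 1 ≤ t')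
    (hdt : t' + 1 = d) (R : Finset K) (hR1 : ∀ g ∈ R, σ g = g ∧ Valued.v g = Valued.v ϖ ^ (2 * t))
    (hR2 : ∀ f : K, σ f = f → Valued.v f = Valued.v ϖ ^ (2 * t) → ∃ g ∈ R, Valued.v (f - g) ≤ Valued.v ϖ ^ (ρ + 2 * t))
    (hR3 : ∀ g ∈ R, ∀ g' ∈ R, Valued.v (g - g') ≤ Valued.v ϖ ^ (ρ + 2 * t) → g = g')
    {κ : K} (hσκ : σ κ = κ) (hκ : Valued.v κ = Valued.v ϖ ^ (2 * t) * Valued.v ϖ ^ (2 * t')) :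
    ∑ g ∈ R, normSign σ (1 + κ / g) = -((Nat.card 𝓀[K] : ℤ) ^ ((ρ + 1) / 2 - 1)) := by
  classical
  have hϖ0 : ϖ ≠ 0 := fun h0 => by have h := hD.2.2.1; rw [h0, map_zero] at h; exact WithZero.coe_ne_zero h.symm
  obtain ⟨hS1, hS2, hS3, hinj⟩ := image_div_repr hϖ0 R hR1 hR2 hR3 hσκ hκ
  rw [← Finset.sum_image (f := fun h => normSign σ (1 + h)) hinj]
  exact sum_normSign_one_add_boundary hD h2 hρ ht' hdt _ hS1 hS2 hS3

/-- **BELOW THE BOUNDARY, INSIDE THE WINDOW**: if `|κ| = |ϖ|^{2t}·|ϖ|^{2t′}` with `1 ≤ t′`, `t′ + 2 ≤ d` and `2d ≤ ρ + 2t′ + 1`, then `Σ_{g ∈ R} ω(1 + κ∕g) = 0` (★ κG-B2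
`sum_normSign_one_add_eq_zero` on `κ∕R`; the whole level `2t′` is stable under `h ↦ n(1+h) − 1`, `n ≡ 1 (ϖ^{2d−2})`, since `2t′ < 2d − 2`).
[cite: Serre1979, Ch. V §3 Prop. 5, Cor. 3] [cite: LanglandsShelstad1987, §3] -/
theorem sum_normSign_one_add_div_eq_zero (hD : IsRamifiedQuadraticDatum σ ϖ d t₂) (h2 : Valued.v (2 : K) < 1) {ρ t t' : ℕ} (ht' : 1 ≤ t') (htd : t' + 2 ≤ d)
    (hwin : 2 * d ≤ ρ + 2 * t' + 1) (R : Finset K) (hR1 : ∀ g ∈ R, σ g = g ∧ Valued.v g = Valued.v ϖ ^ (2 * t))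
    (hR2 : ∀ f : K, σ f = f → Valued.v f = Valued.v ϖ ^ (2 * t) → ∃ g ∈ R, Valued.v (f - g) ≤ Valued.v ϖ ^ (ρ + 2 * t))
    (hR3 : ∀ g ∈ R, ∀ g' ∈ R, Valued.v (g - g') ≤ Valued.v ϖ ^ (ρ + 2 * t) → g = g')
    {κ : K} (hσκ : σ κ = κ) (hκ : Valued.v κ = Valued.v ϖ ^ (2 * t) * Valued.v ϖ ^ (2 * t')) :
    ∑ g ∈ R, normSign σ (1 + κ / g) = 0 := by
  classical
  obtain ⟨-, hvσ, hϖ, -, -, -, -⟩ := id hD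
  have hϖ0 : ϖ ≠ 0 := fun h0 => by rw [h0, map_zero] at hϖ; exact WithZero.coe_ne_zero hϖ.symm
  have hϖ1 : Valued.v ϖ < 1 := by rw [hϖ, ← exp_zero, exp_lt_exp]; norm_num
  obtain ⟨hS1, hS2, hS3, hinj⟩ := image_div_repr hϖ0 R hR1 hR2 hR3 hσκ hκ
  rw [← Finset.sum_image (f := fun h => normSign σ (1 + h)) hinj]
  refine sum_normSign_one_add_eq_zero hD h2 ht' hwin (A := {x : K | σ x = x ∧ Valued.v x = Valued.v ϖ ^ (2 * t')}) (fun g hg => hg) ?_ _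
    (fun h hh => hS1 h hh) (fun f hf => hS2 f hf.1 hf.2) hS3
  -- stability of the level under the twist `h ↦ n(1+h) − 1`
  rintro g ⟨hσg, hvg⟩ n hσn hn1 hnd
  refine ⟨by rw [map_sub, map_mul, map_add, map_one, hσn, hσg], ?_⟩
  rw [show n * (1 + g) - 1 = g + (n - 1) * (1 + g) by ring]
  have hsmall : Valued.v ((n - 1) * (1 + g)) < Valued.v g := by
    rw [map_mul, Valued.v.map_one_add_of_lt (by rw [hvg]; exact pow_lt_one₀ zero_le hϖ1 (by omega)), mul_one, hvg]
    exact hnd.trans_lt (pow_lt_pow_right_of_lt_one₀ ((Valuation.pos_iff _).2 hϖ0) hϖ1 (by omega))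
  rw [Valuation.map_add_eq_of_lt_left _ hsmall, hvg]

/-! ## §3  The twisted sums `Σ_{g ∈ R} ω(g)·ω(1 + κ∕g)` and `Σ_{g ∈ R} ω(g)·ω(1+g)·ω(1 + κ∕g)` vanish -/

/-- **`Σ_{g ∈ R} ω(g)·ω(1+g)^{b}·ω(1 + κ∕g) = 0`** (`b ∈ {0, 1}` encoded by `Φ ∈ {1, ω(1+·)}`) — the common engine of §3: for `2d ≤ ρ + 1`, `1 ≤ t′` and `Φ` a
class function at resolution `ϖ^{ρ+2t}` on the level that is INVARIANT under `g ↦ n·g` for the fixed non-norm `n ≡ 1 (ϖ^{2d−2})`, the twist flips `ω(g)` and fixes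
`Φ(g)·ω(1 + κ∕g)`. [cite: Serre1979, Ch. V §3 Prop. 5, Cor. 3] [cite: LanglandsShelstad1987, §3] -/
theorem sum_normSign_mul_mul_normSign_one_add_div_eq_zero (hD : IsRamifiedQuadraticDatum σ ϖ d t₂) (h2 : Valued.v (2 : K) < 1) {ρ t t' : ℕ}
    (hρ : 2 * d ≤ ρ + 1) (ht' : 1 ≤ t') (R : Finset K) (hR1 : ∀ g ∈ R, σ g = g ∧ Valued.v g = Valued.v ϖ ^ (2 * t))
    (hR2 : ∀ f : K, σ f = f → Valued.v f = Valued.v ϖ ^ (2 * t) → ∃ g ∈ R, Valued.v (f - g) ≤ Valued.v ϖ ^ (ρ + 2 * t))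
    (hR3 : ∀ g ∈ R, ∀ g' ∈ R, Valued.v (g - g') ≤ Valued.v ϖ ^ (ρ + 2 * t) → g = g')
    {κ : K} (hσκ : σ κ = κ) (hκ : Valued.v κ = Valued.v ϖ ^ (2 * t) * Valued.v ϖ ^ (2 * t'))
    (Φ : K → ℤ) (hΦcls : ∀ f f' : K, σ f = f → Valued.v f = Valued.v ϖ ^ (2 * t) → σ f' = f' → Valued.v f' = Valued.v ϖ ^ (2 * t) →
      Valued.v (f - f') ≤ Valued.v ϖ ^ (ρ + 2 * t) → Φ f = Φ f')
    (hΦn : ∀ f n : K, σ f = f → Valued.v f = Valued.v ϖ ^ (2 * t) → σ n = n → Valued.v n = 1 → Valued.v (n - 1) ≤ Valued.v ϖ ^ (2 * (d - 1)) → Φ (n * f) = Φ f) :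
    ∑ g ∈ R, normSign σ g * Φ g * normSign σ (1 + κ / g) = 0 := by
  obtain ⟨-, hvσ, hϖ, -, -, hd1, -⟩ := id hD
  have hϖ0 : ϖ ≠ 0 := fun h0 => by rw [h0, map_zero] at hϖ; exact WithZero.coe_ne_zero hϖ.symm
  have hvϖ : 0 < Valued.v ϖ := (Valuation.pos_iff _).2 hϖ0
  have hϖ1 : Valued.v ϖ < 1 := by rw [hϖ, ← exp_zero, exp_lt_exp]; norm_num
  have hpt : ∀ n : ℕ, Valued.v ϖ ^ n ≠ 0 := fun n => pow_ne_zero _ hvϖ.ne'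
  have hmono : ∀ {a b : ℕ}, a ≤ b → Valued.v ϖ ^ b ≤ Valued.v ϖ ^ a := fun h => pow_le_pow_right_of_le_one' hϖ1.le h
  set A : Set K := {x : K | σ x = x ∧ Valued.v x = Valued.v ϖ ^ (2 * t)} with hAdef
  have hA : ∀ g ∈ A, σ g = g ∧ Valued.v g = Valued.v ϖ ^ (2 * t) := fun g hg => hg
  have hg0 : ∀ f ∈ A, f ≠ 0 := fun f hf h0 => by have h := (hA f hf).2; rw [h0, map_zero] at h; exact (hpt _) h.symm
  -- `κ∕f` on the level: fixed, of valuation `|ϖ|^{2t′} < 1`; `1 + κ∕f` is a fixed unit and `ω(1 + κ∕f)` a class function modulo `𝔭^{ρ+2t}`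
  have hvq : ∀ f ∈ A, Valued.v (κ / f) = Valued.v ϖ ^ (2 * t') := fun f hf => by
    rw [map_div₀, hκ, (hA f hf).2, mul_div_cancel_left₀ _ (hpt _)]
  have hκlt : ∀ f ∈ A, Valued.v (κ / f) < 1 := fun f hf => by
    rw [hvq f hf]; exact pow_lt_one₀ zero_le hϖ1 (by omega)
  have hσ1 : ∀ f ∈ A, σ (1 + κ / f) = 1 + κ / f := fun f hf => by rw [map_add, map_one, map_div₀, hσκ, hf.1]
  have hcls : ∀ f ∈ A, ∀ f' ∈ A, Valued.v (f - f') ≤ Valued.v ϖ ^ (ρ + 2 * t) → normSign σ (1 + κ / f') = normSign σ (1 + κ / f) := by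
    intro f hf f' hf' h
    refine normSign_eq_of_near hD (hσ1 f hf) (hσ1 f' hf') (Valued.v.map_one_add_of_lt (hκlt f hf)) (n := ρ + 2 * t') (by omega) ?_
    have e : (1 : K) + κ / f - (1 + κ / f') = κ * (f' - f) / (f * f') := by field_simp [hg0 f hf, hg0 f' hf']; ring
    rw [e, map_div₀, map_mul, map_mul, hκ, (hA f hf).2, (hA f' hf').2, Valuation.map_sub_swap Valued.v f' f,
      div_le_iff₀ (mul_pos (pow_pos hvϖ _) (pow_pos hvϖ _))]
    calc Valued.v ϖ ^ (2 * t) * Valued.v ϖ ^ (2 * t') * Valued.v (f - f')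
        ≤ Valued.v ϖ ^ (2 * t) * Valued.v ϖ ^ (2 * t') * Valued.v ϖ ^ (ρ + 2 * t) := mul_le_mul_right h _
      _ = Valued.v ϖ ^ (ρ + 2 * t') * (Valued.v ϖ ^ (2 * t) * Valued.v ϖ ^ (2 * t)) := by
          rw [← pow_add, ← pow_add, ← pow_add, ← pow_add]; congr 1; omega
  obtain ⟨n, hσn, hn1, hnd, hnn⟩ := exists_fixed_unit_not_norm_v_sub_one_le hD h2
  have hnd' : Valued.v (n - 1) ≤ Valued.v ϖ ^ (2 * (d - 1)) := by
    rw [v_varpi_pow hϖ]; convert hnd using 2; push_cast; ring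
  have hn0 : n ≠ 0 := fun h => by rw [h, map_zero] at hn1; exact zero_ne_one hn1
  refine sum_eq_zero_of_twist (A := A) (r := Valued.v ϖ ^ (ρ + 2 * t)) R (fun g hg => hR1 g hg) (fun f hf => hR2 f hf.1 hf.2) hR3
    (fun g => normSign σ g * Φ g * normSign σ (1 + κ / g)) (fun f hf f' hf' h => ?_) (fun g => n * g)
    (fun f hf => ⟨by rw [map_mul, hσn, hf.1], by rw [map_mul, hn1, one_mul, hf.2]⟩) (fun f _ f' _ h => ?_) (fun f hf => ?_)
  · rw [(normSign_eq_of_near_level hD hρ (hA f hf).1 (hA f' hf').1 (hA f hf).2 h).symm, hcls f hf f' hf' h,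
      hΦcls f f' (hA f hf).1 (hA f hf).2 (hA f' hf').1 (hA f' hf').2 h]
  · rwa [← mul_sub, map_mul, hn1, one_mul] at h
  · have hf0 := hg0 f hf
    have hnear : Valued.v ((1 + κ / f) - (1 + κ / (n * f))) ≤ Valued.v ϖ ^ (2 * d - 1) := by
      have e : (1 : K) + κ / f - (1 + κ / (n * f)) = (κ / f) * ((n - 1) / n) := by field_simp; ring
      rw [e, map_mul, hvq f hf, map_div₀, hn1, div_one]
      calc Valued.v ϖ ^ (2 * t') * Valued.v (n - 1) ≤ Valued.v ϖ ^ (2 * t') * Valued.v ϖ ^ (2 * (d - 1)) := mul_le_mul_right hnd' _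
        _ ≤ Valued.v ϖ ^ (2 * d - 1) := by rw [← pow_add]; exact hmono (by omega)
    rw [normSign_mul_eq_neg_of_not_norm hD hσn hnn (hA f hf).1 hf0, hΦn f n (hA f hf).1 (hA f hf).2 hσn hn1 hnd',
      normSign_eq_of_near hD (hσ1 f hf) (by rw [map_add, map_one, map_div₀, map_mul, hσκ, hσn, hf.1]) (Valued.v.map_one_add_of_lt (hκlt f hf)) (n := 2 * d - 1) le_rfl hnear]
    ring

/-- **`Σ_{g ∈ R} ω(g)·ω(1 + κ∕g) = 0`** for `2d ≤ ρ + 1`, `1 ≤ t′`, `|κ| = |ϖ|^{2t}·|ϖ|^{2t′}` — slot 1 of the κ-row. [cite: Serre1979, Ch. V §3 Prop. 5, Cor. 3] [cite: LanglandsShelstad1987, §3] -/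
theorem sum_normSign_mul_normSign_one_add_div_eq_zero (hD : IsRamifiedQuadraticDatum σ ϖ d t₂) (h2 : Valued.v (2 : K) < 1) {ρ t t' : ℕ}
    (hρ : 2 * d ≤ ρ + 1) (ht' : 1 ≤ t') (R : Finset K) (hR1 : ∀ g ∈ R, σ g = g ∧ Valued.v g = Valued.v ϖ ^ (2 * t))
    (hR2 : ∀ f : K, σ f = f → Valued.v f = Valued.v ϖ ^ (2 * t) → ∃ g ∈ R, Valued.v (f - g) ≤ Valued.v ϖ ^ (ρ + 2 * t))
    (hR3 : ∀ g ∈ R, ∀ g' ∈ R, Valued.v (g - g') ≤ Valued.v ϖ ^ (ρ + 2 * t) → g = g')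
    {κ : K} (hσκ : σ κ = κ) (hκ : Valued.v κ = Valued.v ϖ ^ (2 * t) * Valued.v ϖ ^ (2 * t')) :
    ∑ g ∈ R, normSign σ g * normSign σ (1 + κ / g) = 0 := by
  have h := sum_normSign_mul_mul_normSign_one_add_div_eq_zero hD h2 hρ ht' R hR1 hR2 hR3 hσκ hκ (fun _ => 1)
    (fun _ _ _ _ _ _ _ => rfl) (fun _ _ _ _ _ _ _ => rfl)
  simpa only [mul_one] using h

/-- **`Σ_{g ∈ R} ω(g)·ω(1+g)·ω(1 + κ∕g) = 0`** for `2d ≤ ρ + 1`, `1 ≤ t`, `1 ≤ t′`, `|κ| = |ϖ|^{2t}·|ϖ|^{2t′}` — slot 0 of the κ-row: `ω(1+g)` is a class function on the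
level at resolution `ϖ^{ρ+2t}` and is fixed by `g ↦ n·g` (`|g(n−1)| ≤ |ϖ|^{2t+2d−2} ≤ |ϖ|^{2d−1}`). [cite: Serre1979, Ch. V §3 Prop. 5, Cor. 3] [cite: LanglandsShelstad1987, §3] -/
theorem sum_normSign_mul_normSign_one_add_mul_normSign_one_add_div_eq_zero (hD : IsRamifiedQuadraticDatum σ ϖ d t₂) (h2 : Valued.v (2 : K) < 1) {ρ t t' : ℕ}
    (hρ : 2 * d ≤ ρ + 1) (ht : 1 ≤ t) (ht' : 1 ≤ t') (R : Finset K) (hR1 : ∀ g ∈ R, σ g = g ∧ Valued.v g = Valued.v ϖ ^ (2 * t))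
    (hR2 : ∀ f : K, σ f = f → Valued.v f = Valued.v ϖ ^ (2 * t) → ∃ g ∈ R, Valued.v (f - g) ≤ Valued.v ϖ ^ (ρ + 2 * t))
    (hR3 : ∀ g ∈ R, ∀ g' ∈ R, Valued.v (g - g') ≤ Valued.v ϖ ^ (ρ + 2 * t) → g = g')
    {κ : K} (hσκ : σ κ = κ) (hκ : Valued.v κ = Valued.v ϖ ^ (2 * t) * Valued.v ϖ ^ (2 * t')) :
    ∑ g ∈ R, normSign σ g * normSign σ (1 + g) * normSign σ (1 + κ / g) = 0 := by
  obtain ⟨-, hvσ, hϖ, -, -, hd1, -⟩ := id hD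
  have hϖ0 : ϖ ≠ 0 := fun h0 => by rw [h0, map_zero] at hϖ; exact WithZero.coe_ne_zero hϖ.symm
  have hϖ1 : Valued.v ϖ < 1 := by rw [hϖ, ← exp_zero, exp_lt_exp]; norm_num
  have hmono : ∀ {a b : ℕ}, a ≤ b → Valued.v ϖ ^ b ≤ Valued.v ϖ ^ a := fun h => pow_le_pow_right_of_le_one' hϖ1.le h
  have hlt1 : ∀ f : K, Valued.v f = Valued.v ϖ ^ (2 * t) → Valued.v f < 1 := fun f hf => by rw [hf]; exact pow_lt_one₀ zero_le hϖ1 (by omega)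
  refine sum_normSign_mul_mul_normSign_one_add_div_eq_zero hD h2 hρ ht' R hR1 hR2 hR3 hσκ hκ (fun g => normSign σ (1 + g)) ?_ ?_
  · intro f f' hσf hvf hσf' hvf' h
    refine (normSign_eq_of_near hD (by rw [map_add, map_one, hσf]) (by rw [map_add, map_one, hσf']) (Valued.v.map_one_add_of_lt (hlt1 f hvf))
      (n := ρ + 2 * t) (by omega) ?_).symm
    rwa [show (1 : K) + f - (1 + f') = f - f' by ring]
  · intro f n hσf hvf hσn hn1 hnd
    refine normSign_eq_of_near hD (by rw [map_add, map_one, hσf]) (by rw [map_add, map_one, map_mul, hσn, hσf]) (Valued.v.map_one_add_of_lt (hlt1 f hvf))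
      (n := 2 * d - 1) le_rfl ?_
    rw [show (1 : K) + f - (1 + n * f) = -((n - 1) * f) by ring, Valuation.map_neg, map_mul, hvf]
    calc Valued.v (n - 1) * Valued.v ϖ ^ (2 * t) ≤ Valued.v ϖ ^ (2 * (d - 1)) * Valued.v ϖ ^ (2 * t) := mul_le_mul_left hnd _
      _ ≤ Valued.v ϖ ^ (2 * d - 1) := by rw [← pow_add]; exact hmono (by omega)

end Sums

end Summit.HodgeConjecture.HodgeConjecture.Cruxes.H413.F0P3cDyRamKappaClassFootSums

end
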